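import Literature.NumberTheory.EllipticCurves.Sprung2024.ChromaticSmallControl
import HarnessLib

/-!
# Sprung 2024, §5.2, proof of Lemma 5.5, the case `v = p`: "`r_p` is injective" — the ♯/♭ local
# condition controls the classical one at the bottom layer (named facts on the REAL objects
# `E^⋆_{∞,𝔭}` = `Sprung2012.sharpFlatLocalKummerOverOfEmb … (colemanKer …)`)

Topic `Literature/NumberTheory/EllipticCurves`, cluster `Sprung2024`. Companion of
`Sprung2024/ChromaticSmallControl.lean` (`lem56_…` / `lem56AllN_…`: §5.2 Lemma 5.6, the Small
Control Theorem, corollary form) and of the `Proofs` file `Sprung2024/ChromaticSmallControlProofs.lean`,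
which PROVES Lemma 5.6 (corollary form) in the kernel from the single local statement vendored here
(`Sprung2024.finite_sharpFlat_coinvariants_of_finite_selmer_of_sharpFlatLocalKummer_rat`; the
one-line compositions `lem55… → lem56…` live with the consumer, keeping this file statements-only).
Source (version of record): F. Ito Sprung, *On Iwasawa main conjectures for elliptic curves at
supersingular primes: beyond the case `a_p = 0`*, Adv. Math. **449** (2024) 109741 [Sprung2024]
(NSF Public Access Repository copy, purl 10611567, store `paper:url-4cf1d13002d7`; locators
`p. NN` = journal page); preprint twin arXiv:1610.10017 §4, proof of Lemma 4.5 (p. 15). TWO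
published statements vendored as NAMED FACTS (`def … : Prop`, nothing asserted, no `_holds`;
D-0014); statements only, net debt +2. Filed by cell `bsd-ssimc`, seat `bsd-ssimc-k3c5-kdot-split`
g5 (object «KDOT-CTRL-KERNEL»), for the crux-5 split of route K3 `SignedLowerHalves` (support K2
`SharpFlatRankZeroConverseAtThree` = stmt-BirchSwinnertonDyer-19877, whose kernel road p486206
consumed `lem56AllN_…`; after the `Proofs` file it consumes the fact below instead). HONEST
FRAMING: nothing about any curve is asserted; no census cell moves; BSD is not proved by any of this.

## The printed statement (§5.2, proof of Lemma 5.5, p. 40), verbatim, and the form vendored here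

Setting (p. 39): `E♯_{∞,p}` (resp. `E♭_{∞,p}`) "the exact annihilator of `ker Col♯_p` (resp.
`ker Col♭_p`) under the local Tate pairing, cf. [64, Definition 7.9]"; "`E♯_{0,p} = E♭_{0,p} =
E(ℚ_p) ⊗ ℚ_p/ℤ_p`"; `𝒢⋆(ℚ_n) = Im( H¹(ℚ_n, E[p^∞]) → H¹(ℚ_{n,p}, E[p^∞])/E⋆_{n,p} × ∏_{v≠p}
H¹(ℚ_{n,v}, E[p^∞])/E(ℚ_{n,v}) ⊗ ℚ_p/ℤ_p )` for `n = 0` or `n = ∞`; the diagram (p. 39) with rows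
`0 → Sel(E, ℚ) → H¹(ℚ, E[p^∞]) → 𝒢⋆(ℚ) → 0` and
`0 → Sel⋆(E, ℚ_∞)^Γ → H¹(ℚ_∞, E[p^∞])^Γ → 𝒢⋆(ℚ_∞)^Γ`, right vertical map `g`;
`r : 𝒫_E(ℚ_0) → 𝒫_E(ℚ_∞)` (p. 40). Proof of **Lemma 5.5** (p. 40), the case `v = p`, verbatim:
"It thus remains to treat the case `v = p`. (Note that the methods in [18, Lemma 3.4] do not apply
since ordinarity is a key assumption there.) We want to show that the map
`H¹(ℚ_p, E[p^∞]) / E(ℚ_p) ⊗ ℚ_p/ℤ_p ⟶(r_p) H¹(ℚ_{p,∞}, E[p^∞]) / E♯_{∞,p}` is injective. As in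
[32, Proof of Proposition 9.2], we consider the following commutative diagram with exact sequences,
were `X` is the cyclotomic variable: `(ker Col⋆_p)_X → (H¹_Iw)_X → (H¹_Iw / ker Col⋆_p)_X → 0`
over `0 → ker Col⋆_{p,0} → H¹(k_0, T) → H¹(k_0, T)/ker Col⋆_{p,0}`, where
`H¹_Iw = lim←_n H¹(ℚ_{p,n}, T)`. By construction, the right vertical map is an isomorphism. The
middle vertical map is a surjection by [64, Lemma 2.3]. The snake lemma thus shows that the left
vertical map is surjective. Taking Pontryagin duals, we see that `r_p` is injective, as claimed."
([18] = Greenberg LNM 1716; [32] = Kobayashi 2003; [64] = Sprung 2012; the display prints `E♯` for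
the generic colour `⋆ ∈ {♯, ♭}` of the subsection.) This is the one supersingular-specific input of
the control argument (Lemma 5.6, p. 41: "The proof of [32, Theorem 9.3] with `n = 0` with the
adjustment that `r_p` is injective (cf. Lemma 5.5) works").

VENDORED FORM — the claim ON THE CLASSES COMING FROM `H¹(ℚ, E[p^∞])` (the form the diagram
consumes: `ker g ⊆ ker r ∩ 𝒢⋆(ℚ)`), in the tree's vocabulary. With `κ` the cyclotomic
`ℤ_p`-extension, `h_0 = W.layerToInfty κ 0 : H¹(ℚ, E[p^∞]) → H¹(ℚ_∞, E[p^∞])`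
(`κ.layerSubgroup 0 = Γ_ℚ`, `ZpExtension.layerSubgroup_zero`), `v ∋ p` the place of `ℚ` above `p`
with the chosen embedding `ι = closureEmb (v.adicCompletion ℚ)` (the place `𝔭` of `ℚ_∞`), and
Sprung's `E⋆_{∞,𝔭}` transcribed (file `Sprung2012/SharpFlatSelmer.lean`, Def. 7.9) as the subgroup
`sharpFlatLocalKummerOverOfEmb W p κ.kerSubgroup ι (localTowerPointsOfEmb κ ι W) (colemanKer κ ι W a_p g c ⋆)`
of the classes of `H¹(ℚ_∞, E[p^∞])` whose restriction to `Gal(ℚ̄_p/ℚ_{∞,𝔭})` is the Kummer class of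
some `x ⊗ p^{-k}`, `x ∈ E(ℚ_{∞,𝔭})`, pairing integrally with `Ker Col⋆`: **for every
`y ∈ H¹(ℚ, E[p^∞])`, if `h_0 y` satisfies the `⋆`-condition at `𝔭` (`loc_𝔭(res y) ∈ E⋆_{∞,𝔭}`,
i.e. `r_p(loc_p y) = 0`), then `y` satisfies the classical local condition at `p`
(`y ∈ W.localKerOver p (κ.layerSubgroup 0) (v.adicCompletion ℚ)`: `loc_p y ↦ 0` in `H¹(ℚ_p, E)`,
i.e. `loc_p y ∈ E(ℚ_p) ⊗ ℚ_p/ℤ_p = E⋆_{0,p}`).** `TODO(general form): r_p injective on all of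
H¹(ℚ_p, E[p^∞])/E(ℚ_p) ⊗ ℚ_p/ℤ_p` (local classes need not come from `H¹(ℚ, E[p^∞])`; the tree's
`⋆`-condition is phrased on classes over `K_∞` through their local restriction, as
`Kobayashi2003.localKummerOverOfEmb`, so the global-class form is the statable one and is the one
the control diagram uses). Standing hypotheses as printed, kept as binders: Thm. 5.3's "square-free
conductor `N`" (`W.IsSemistable (𝓞 ℚ)`), "supersingular reduction at `p ≠ 2`" (`p ≠ 2`,
`W.HasGoodReductionAtPrime p`, `p ∣ a_p`); the setting of `Sprung2012.thm22_exists_isHondaSystem`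
(cyclotomic `κ`, place `v ∋ p`, local lift `g` of a topological generator, Honda system `(cneg, c)`,
Thm. 2.2) under which `colemanKer … ⋆` is `Ker Col⋆_p`. NOT kept: "`L(E,1) ≠ 0`" and
"Conjecture 3.33" (§5.2's other standing assumptions; the displayed claim and its proof — Kobayashi's
Prop. 9.2 diagram and [64, Lemma 2.3] — are statements about `E/ℚ_p` and the local tower only), and
Lemma 5.5's own assumption "(Sel⋆(E, ℚ_∞))_Γ finite" (used for its Tamagawa formula, not for the
`v = p` clause). Accordingly:

* `lem55_sharpFlat_localKerOver_of_layerToInfty_mem` — WITH `W.IsSemistable (𝓞 ℚ)`;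
* `lem55AllN_sharpFlat_localKerOver_of_layerToInfty_mem` — the same WITHOUT `W.IsSemistable (𝓞 ℚ)`.
  PRINT STATUS: stronger than the section-level statement; justified because the claim is LOCAL at
  `p` (its objects `H¹(ℚ_p, ·)`, `H¹(ℚ_{p,∞}, ·)`, `E(ℚ_p)`, `Col⋆_p`, `H¹_Iw` depend on `E/ℚ_p`
  alone; the conductor away from `p` does not enter), and for the same reasons as the ACCEPTED
  `lem56AllN_…` / `lem59AllN_…` (Ray–Sprung, Ann. Inst. Fourier 75 (2025) p. 2343, attribute the
  resulting formulas "[26, Lemmas 4.4, 4.5, 4.8] … all assuming `F = ℚ`" with no conductor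
  condition). Flag `Sprung24-§5.2-L5.5p-allN-local` for reviewers and consumers.

Binder order = `lem56AllN_…`'s minus the generator `γ` and the dual datum `D` (the statement concerns
classes, not `X⋆`), plus the class `y`. With either fact the `Proofs` file yields the corresponding
`lem56…` (consumer `Theorems/SignedLowerHalvesSprungLowerHalfAtThreeSplitConverseLocal.lean`).

References: [Sprung2024] §5.2 pp. 39–41 (setting, Lemma 5.5 and proof, Lemma 5.6); arXiv:1610.10017
§4 p. 15; [Kobayashi2003] Prop. 9.2, Thm. 9.3; [Sprung2012] Lemma 2.3, Def. 7.9, Def. 7.11;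
[GreenbergLNM1716] §3 Lemmas 3.3–3.5; [RaySprung2025] p. 2343.
Design: statements only (two `def … : Prop`), `namespace Literature.NumberTheory.EllipticCurves.Sprung2024`;
no instance, no notation.
-/

noncomputable section

open scoped Classical NumberField

open NumberField IsDedekindDomain WeierstrassCurve Literature.NumberTheory.EllipticCurves
  Literature.NumberTheory.EllipticCurves.ZpExtension Literature.NumberTheory.EllipticCurves.Sprung2017
  Literature.NumberTheory.EllipticCurves.Sprung2012

namespace Literature.NumberTheory.EllipticCurves.Sprung2024

/-- **Sprung 2024, proof of Lemma 5.5, the case `v = p` ("`r_p` is injective"), on the classes of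
`H¹(ℚ, E[p^∞])`, under §5.2's standing square-free hypothesis.** Printed (p. 40): "We want to show
that the map `H¹(ℚ_p, E[p^∞]) / E(ℚ_p) ⊗ ℚ_p/ℤ_p ⟶(r_p) H¹(ℚ_{p,∞}, E[p^∞]) / E⋆_{∞,p}` is
injective. … Taking Pontryagin duals, we see that `r_p` is injective, as claimed." Vendored: for
`W/ℚ` with square-free conductor (`W.IsSemistable (𝓞 ℚ)`), `p ≠ 2` of good supersingular reduction
(`p ∣ a_p`), the cyclotomic `κ`, the place `v ∋ p` with its chosen embedding, a local lift `g` of a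
topological generator, a Honda system `(cneg, c)` (so that `colemanKer … ⋆ = Ker Col⋆_p`), either
colour `⋆`, and every class `y ∈ H¹(ℚ, E[p^∞])` (`κ.layerSubgroup 0 = Γ_ℚ`): if the restriction
`h_0 y ∈ H¹(ℚ_∞, E[p^∞])` satisfies Sprung's `⋆`-condition at `𝔭` — it lies in
`sharpFlatLocalKummerOverOfEmb … (colemanKer … ⋆)`, i.e. `loc_𝔭(res y) ∈ E⋆_{∞,𝔭}`, i.e.
`r_p(loc_p y) = 0` — then `y` satisfies the classical local condition at `p`
(`localKerOver`: `loc_p y ↦ 0 ∈ H¹(ℚ_p, E)`, i.e. `loc_p y ∈ E(ℚ_p) ⊗ ℚ_p/ℤ_p`). The consequence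
of the printed injectivity for classes coming from `H¹(ℚ, E[p^∞])`; `TODO(general form)`: every
class of `H¹(ℚ_p, E[p^∞])`. Nothing is asserted; no `_holds` is expected.
[cite: Sprung2024, §5.2 proof of Lemma 5.5, case v = p (p. 40)] [cite: Kobayashi2003, Prop. 9.2]
[cite: Sprung2012, Lemma 2.3 and Def. 7.9] -/
def lem55_sharpFlat_localKerOver_of_layerToInfty_mem : Prop :=
  ∀ (W : WeierstrassCurve ℚ) [W.IsElliptic] [W.IsGloballyMinimal] (p : ℕ) [Fact p.Prime],
    p ≠ 2 → W.IsSemistable (𝓞 ℚ) → W.HasGoodReductionAtPrime p → (p : ℤ) ∣ W.frobeniusTrace p →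
    ∀ (κ : ZpExtension ℚ p), κ.IsCyclotomic →
    ∀ (v : HeightOneSpectrum (𝓞 ℚ)), (p : 𝓞 ℚ) ∈ v.asIdeal →
    ∀ (g : Field.absoluteGaloisGroup (v.adicCompletion ℚ)),
      κ.IsTopGenerator (resGalOfEmb (closureEmb (K := ℚ) (v.adicCompletion ℚ)) g) →
    ∀ (cneg : localPoints W (v.adicCompletion ℚ)) (c : ℕ → localPoints W (v.adicCompletion ℚ)),
      IsHondaSystem κ (closureEmb (K := ℚ) (v.adicCompletion ℚ)) W (W.frobeniusTrace p) g cneg c →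
    ∀ (col : Chroma) (y : W.subgroupH1 p (κ.layerSubgroup 0)),
      W.layerToInfty κ 0 y ∈ sharpFlatLocalKummerOverOfEmb W p κ.kerSubgroup
          (closureEmb (K := ℚ) (v.adicCompletion ℚ))
          (localTowerPointsOfEmb κ (closureEmb (K := ℚ) (v.adicCompletion ℚ)) W)
          (colemanKer κ (closureEmb (K := ℚ) (v.adicCompletion ℚ)) W (W.frobeniusTrace p) g c col) →
      y ∈ W.localKerOver p (κ.layerSubgroup 0) (v.adicCompletion ℚ)

/-- **Sprung 2024, proof of Lemma 5.5, the case `v = p` ("`r_p` is injective"), on the classes of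
`H¹(ℚ, E[p^∞])`, for every conductor.** The body of
`lem55_sharpFlat_localKerOver_of_layerToInfty_mem` WITHOUT the binder `W.IsSemistable (𝓞 ℚ)`
(§5.2's standing "square-free conductor"; the displayed claim and its printed proof — the
specialisation diagram of `Col⋆_p` on `H¹_Iw = lim← H¹(ℚ_{p,n}, T)`, Kobayashi's Prop. 9.2, and
[64, Lemma 2.3] — concern `E/ℚ_p` and the local cyclotomic tower only): `p ≠ 2` good supersingular
(`p ∣ a_p`), cyclotomic `κ`, `v ∋ p`, local lift `g`, Honda system `(cneg, c)`, either colour, every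
`y ∈ H¹(ℚ, E[p^∞])`: `h_0 y` in the `⋆`-condition at `𝔭` ⟹ `y` in the classical condition at `p`.
PRINT STATUS: stronger than the section-level statement of [Sprung2024]; flag
`Sprung24-§5.2-L5.5p-allN-local` (module docstring). Nothing is asserted; no `_holds` is expected.
[cite: Sprung2024, §5.2 proof of Lemma 5.5, case v = p (p. 40)]
[cite: RaySprung2025, p. 2343 (§1.2, the sentence on Sel♯/Sel♭ and [26, Lemmas 4.4, 4.5, 4.8])]
[cite: Kobayashi2003, Prop. 9.2] [cite: Sprung2012, Lemma 2.3 and Def. 7.9] -/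
def lem55AllN_sharpFlat_localKerOver_of_layerToInfty_mem : Prop :=
  ∀ (W : WeierstrassCurve ℚ) [W.IsElliptic] [W.IsGloballyMinimal] (p : ℕ) [Fact p.Prime],
    p ≠ 2 → W.HasGoodReductionAtPrime p → (p : ℤ) ∣ W.frobeniusTrace p →
    ∀ (κ : ZpExtension ℚ p), κ.IsCyclotomic →
    ∀ (v : HeightOneSpectrum (𝓞 ℚ)), (p : 𝓞 ℚ) ∈ v.asIdeal →
    ∀ (g : Field.absoluteGaloisGroup (v.adicCompletion ℚ)),
      κ.IsTopGenerator (resGalOfEmb (closureEmb (K := ℚ) (v.adicCompletion ℚ)) g) →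
    ∀ (cneg : localPoints W (v.adicCompletion ℚ)) (c : ℕ → localPoints W (v.adicCompletion ℚ)),
      IsHondaSystem κ (closureEmb (K := ℚ) (v.adicCompletion ℚ)) W (W.frobeniusTrace p) g cneg c →
    ∀ (col : Chroma) (y : W.subgroupH1 p (κ.layerSubgroup 0)),
      W.layerToInfty κ 0 y ∈ sharpFlatLocalKummerOverOfEmb W p κ.kerSubgroup
          (closureEmb (K := ℚ) (v.adicCompletion ℚ))
          (localTowerPointsOfEmb κ (closureEmb (K := ℚ) (v.adicCompletion ℚ)) W)
          (colemanKer κ (closureEmb (K := ℚ) (v.adicCompletion ℚ)) W (W.frobeniusTrace p) g c col) →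
      y ∈ W.localKerOver p (κ.layerSubgroup 0) (v.adicCompletion ℚ)

end Literature.NumberTheory.EllipticCurves.Sprung2024

end
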